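import Summits.Ventures.CertifiedArithmetic.LowPrec.SRTreeLimitedBitsDyadic
import Summits.Ventures.CertifiedArithmetic.LowPrec.SRFewBitsDeadBand
import HarnessLib

/-!
# Bit thresholds: when limited-randomness SR loses NOTHING
# (venture file LXXVII of the SR slice)

HONEST FRAMING: certified error envelopes and provably optimal rounding/accumulation schemes for
low-precision formats under stated cost models; every table by two implementations; no hardware or
vendor claims.

Files XIX–LXXVI priced `N` random bits by ENVELOPES (`ε = 2^{-N}` drift per rounding) and exhibited
what few bits break (stagnation, dead bands, order-dependent bias).  This file is the other side of
the ledger: a FINITE NUMBER OF BITS beyond which the IEEE P3109 rules StochasticA/B/C reproduce the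
exact-SR process EXACTLY — same law for every test function, every horizon, every start — because
every up-probability the computation can ever meet is an `N`-bit dyadic (`SRTreeLimitedBitsDyadic`).

* `dyadic_mono` — more bits never hurt (`Dyadic N η → Dyadic M η` for `N ≤ M`).
* TREES (`dyadicT_of_pairs`): if every PAIR of format values has an `N`-dyadic up-probability
  (`∀ a b ∈ F, Dyadic N (pUp F (a + b))` — a finite, kernel-decidable table) then EVERY summation tree
  with format-valued leaves is `N`-dyadic, hence (`treeExpQ_eq_treeExp_of_pairs`) the `N`-bit model
  IS the exact-SR model for every order and every test function.
* RECURSIONS (`DyadicR`, `recExpQ_eq_recExp_of_dyadicR`, `dyadicR_of_forall_mem`): the same for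
  `x ← round(g k x)` — if every update of a format value has an `N`-dyadic up-probability, the
  `N`-bit recursion from any format start is the exact-SR recursion of `SRRecursion`, for all `n`.
* FP4 E2M1 KERNEL THRESHOLDS (`decide +kernel` over the finite tables):
  - PAIRS: `e2m1_pairs_dyadic_two` — TWO bits suffice for every sum of two E2M1 values (225 pairs),
    hence (`e2m1_twoBits_tree_exact`) StochasticA/B/C with `N ≥ 2` bits reproduce exact SR for
    EVERY summation tree of FP4 data; SHARP: with one bit the FP4 data `(1, 1/2, 1, 3/2)` is biased in
    two of three orders (`SRTreeLimitedBitsDyadic.oneBit_order_decides_bias_A`; `e2m1_pairs_oneBit_fails`);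
  - COUNTING: `e2m1_succ_dyadic_one` — ONE bit reproduces exact-SR counting `s + 1 + 1 + ⋯` from every
    FP4 start (`e2m1_oneBit_counter_exact`), whereas in E3M2 one bit stagnates at `16`
    (`SRLimitedBitsOptimal.e3m2_ones_oneBit_stochasticC_absorbed`) and the threshold is TWO
    (`e3m2_succ_dyadic_two`, `e3m2_twoBits_counter_exact`);
  - THE EMA `x ← ¾x + ¼·(3/2)` (`SRFewBitsDeadBand.ema34`): the complete bit ladder — `N = 0` RN dead
    band, `N = 1` spurious fixed points (file LXXVI), `N = 2, 3` every cell moves but the law is NOT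
    the exact one (`e2m1_ema34_threeBits_inexact`: from `6` the 3-bit means are `19/4 | 5 | 5`
    against the exact `39/8`), `N ≥ 4` EXACT from every start forever (`e2m1_ema34_dyadic_four`,
    `e2m1_ema34_fourBits_exact`).
  = HOME `certs/sr/gen15/thresholds` (two implementations: closed-form grid argument vs enumeration).

Placement: the one-step remark `SR_{p,r}(x) = SR_p(x)` for `x` of precision `p + r` (El Arar–Fasi–
Filip–Mikaitis 2025, Rem. 2) made global: thresholds after which a whole COMPUTATION under few-bit
SR is the exact-SR computation in law.  No claim about any implementation.
-/

namespace Summit.Ventures.CertifiedArithmetic.LowPrec.SR.LimitedBits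

open Literature.ComputerArithmetic.P3109
open Literature.ComputerArithmetic.ConnollyHighamMary2021
open Summit.Ventures.CertifiedArithmetic.LowPrec.SR
open Finset STree

section Generic

variable {K : Type*} [Field K] [LinearOrder K] [IsStrictOrderedRing K] [FloorRing K]

omit [LinearOrder K] [IsStrictOrderedRing K] [FloorRing K] in
/-- More random bits never hurt: an `N`-bit dyadic is an `M`-bit dyadic for every `M ≥ N`. -/
theorem dyadic_mono {N M : ℕ} (hNM : N ≤ M) {η : K} (h : Dyadic N η) : Dyadic M η := by
  obtain ⟨m, hm⟩ := h
  refine ⟨m * 2 ^ (M - N), ?_⟩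
  push_cast
  rw [hm, mul_assoc, ← pow_add, Nat.add_sub_cancel' hNM]

/-! ### Trees: a pair table makes every tree with format-valued leaves dyadic -/

omit [IsStrictOrderedRing K] [FloorRing K] in
/-- If every sum of two format values has an `N`-dyadic up-probability, every summation tree with
format-valued leaves is `N`-dyadic (every node adds two format values). -/
theorem dyadicT_of_pairs {F : Finset K} (hF : F.Nonempty) {N : ℕ}
    (hp : ∀ a ∈ F, ∀ b ∈ F, Dyadic N (pUp F (a + b))) :
    ∀ T : STree K, LeavesIn F T → DyadicT F N T
  | .leaf _, _ => trivial
  | .node l r, ⟨hl, hr⟩ => ⟨dyadicT_of_pairs hF hp l hl, dyadicT_of_pairs hF hp r hr,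
      allOut_mono F l (fun a ha => allOut_mono F r (fun b hb => hp a ha b hb)
        (allOut_mem_of_leavesIn hF r hr)) (allOut_mem_of_leavesIn hF l hl)⟩

omit [IsStrictOrderedRing K] [FloorRing K] in
/-- **Pair threshold ⇒ every order is exact.** Under the pair table, any rule fixing the `N`-bit
dyadics gives the exact-SR tree model for every tree with format-valued leaves and every `f`. -/
theorem treeExpQ_eq_treeExp_of_pairs {F : Finset K} (hF : F.Nonempty) {q : K → K} {N : ℕ}
    (hq : ∀ η, Dyadic N η → q η = η) (hp : ∀ a ∈ F, ∀ b ∈ F, Dyadic N (pUp F (a + b)))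
    (T : STree K) (hT : LeavesIn F T) (f : K → K) : treeExpQ F q T f = treeExp F T f :=
  treeExpQ_eq_treeExp_of_dyadicT F hq T f (dyadicT_of_pairs hF hp T hT)

/-! ### Recursions: dyadic paths are exact -/

/-- `DyadicR F N g n s`: along every branch of the recursion `x ← round(g k x)` from `s`, every
pre-rounding value has an `N`-dyadic up-probability (a `PreAll` path predicate; decidable). -/
def DyadicR (F : Finset K) (N : ℕ) (g : ℕ → K → K) (n : ℕ) (s : K) : Prop :=
  PreAll F g n (fun c => Dyadic N (pUp F c)) s

/-- `DyadicR` is decidable (kernel-checkable on concrete data). -/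
instance instDecidableDyadicR (F : Finset K) (N : ℕ) (g : ℕ → K → K) (n : ℕ) (s : K) :
    Decidable (DyadicR F N g n s) := by
  unfold DyadicR; infer_instance

omit [IsStrictOrderedRing K] [FloorRing K] in
/-- **Dyadic recursions are exact.** If every step on every branch is `N`-dyadic and `q` fixes the
`N`-bit dyadics, the limited-randomness recursion model `recExpQ` equals the exact-SR model `recExp`
for every test function. -/
theorem recExpQ_eq_recExp_of_dyadicR (F : Finset K) {q : K → K} {N : ℕ}
    (hq : ∀ η, Dyadic N η → q η = η) (g : ℕ → K → K) (n : ℕ) (f : K → K) (s : K)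
    (h : DyadicR F N g n s) : recExpQ F q g n f s = recExp F g n f s := by
  induction n generalizing g s with
  | zero => rfl
  | succ n ih =>
      obtain ⟨h0, hu, hd⟩ := h
      simp only [recExpQ, recExp]
      rw [stepQ_eq_step_of_dyadic F hq _ _ h0]
      unfold step
      rw [ih _ _ hu, ih _ _ hd]

omit [IsStrictOrderedRing K] [FloorRing K] in
/-- A STATE TABLE makes every path dyadic: if every update of a format value has an `N`-dyadic
up-probability, the recursion from a format start is `N`-dyadic for every horizon (rounded values
are format values again). -/
theorem dyadicR_of_forall_mem {F : Finset K} (hF : F.Nonempty) {N : ℕ} {g : ℕ → K → K}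
    (hg : ∀ k, ∀ x ∈ F, Dyadic N (pUp F (g k x))) {s : K} (hs : s ∈ F) (n : ℕ) :
    DyadicR F N g n s := by
  induction n generalizing g s with
  | zero => trivial
  | succ n ih =>
      exact ⟨hg 0 s hs, ih (fun k x hx => hg (k + 1) x hx) (up_mem hF _),
        ih (fun k x hx => hg (k + 1) x hx) (dn_mem hF _)⟩

omit [IsStrictOrderedRing K] [FloorRing K] in
/-- Hence: under a state table, any rule fixing the `N`-bit dyadics reproduces the exact-SR
recursion from every format start, for every horizon and every test function. -/
theorem recExpQ_eq_recExp_of_forall_mem {F : Finset K} (hF : F.Nonempty) {q : K → K} {N : ℕ}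
    (hq : ∀ η, Dyadic N η → q η = η) {g : ℕ → K → K}
    (hg : ∀ k, ∀ x ∈ F, Dyadic N (pUp F (g k x))) {s : K} (hs : s ∈ F) (n : ℕ) (f : K → K) :
    recExpQ F q g n f s = recExp F g n f s :=
  recExpQ_eq_recExp_of_dyadicR F hq g n f s (dyadicR_of_forall_mem hF hg hs n)

/-- The three P3109 rules with `M ≥ N` bits fix the `N`-bit dyadics. -/
theorem probAwayABC_of_dyadic_le {N M : ℕ} (hNM : N ≤ M) :
    (∀ η : K, Dyadic N η → probAwayA M η = η) ∧ (∀ η : K, Dyadic N η → probAwayB M η = η) ∧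
    (∀ η : K, Dyadic N η → probAwayC M η = η) :=
  ⟨fun _ h => probAwayA_of_dyadic (dyadic_mono hNM h),
   fun _ h => probAwayB_of_dyadic (dyadic_mono hNM h),
   fun _ h => probAwayC_of_dyadic (dyadic_mono hNM h)⟩

end Generic

/-! ### FP4 / FP6 kernel thresholds -/

section Thresholds

open FP4

/-- **Pair table, FP4**: every sum of two E2M1 values has a 2-bit dyadic up-probability in E2M1
(225 pairs; up-probabilities `∈ {0, 1/4, 1/2, 3/4}`). -/
theorem e2m1_pairs_dyadic_two : ∀ a ∈ e2m1, ∀ b ∈ e2m1, Dyadic 2 (pUp e2m1 (a + b)) := by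
  decide +kernel

/-- … and ONE bit does not suffice for pairs: `(−6) + 1/2 = −11/2 ∈ (−6, −4)` has up-probability
`1/4`. -/
theorem e2m1_pairs_oneBit_fails : ¬ Dyadic 1 (pUp e2m1 ((-6 : ℚ) + 1/2)) := by
  decide +kernel

/-- **Two random bits reproduce exact SR for EVERY summation tree of FP4 data** (any order, any
size, every test function: same law, mean, variance, tails), under StochasticA, B and C with any
`N ≥ 2` bits.  Sharp: with one bit the FP4 data `(1, 1/2, 1, 3/2)` is biased in the pairwise and
left-to-right orders (`oneBit_order_decides_bias_A/B/C`). -/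
theorem e2m1_twoBits_tree_exact {N : ℕ} (hN : 2 ≤ N) (T : STree ℚ) (hT : LeavesIn e2m1 T)
    (f : ℚ → ℚ) :
    treeExpQ e2m1 (probAwayA N) T f = treeExp e2m1 T f ∧
    treeExpQ e2m1 (probAwayB N) T f = treeExp e2m1 T f ∧
    treeExpQ e2m1 (probAwayC N) T f = treeExp e2m1 T f :=
  ⟨treeExpQ_eq_treeExp_of_pairs e2m1_nonempty (probAwayABC_of_dyadic_le hN).1
      e2m1_pairs_dyadic_two T hT f,
   treeExpQ_eq_treeExp_of_pairs e2m1_nonempty (probAwayABC_of_dyadic_le hN).2.1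
      e2m1_pairs_dyadic_two T hT f,
   treeExpQ_eq_treeExp_of_pairs e2m1_nonempty (probAwayABC_of_dyadic_le hN).2.2
      e2m1_pairs_dyadic_two T hT f⟩

/-- In particular two bits are exactly UNBIASED on every FP4 tree without saturation. -/
theorem e2m1_twoBits_tree_unbiased {N : ℕ} (hN : 2 ≤ N) (T : STree ℚ) (hT : LeavesIn e2m1 T)
    (hs : NoSatT e2m1 T) :
    treeExpQ e2m1 (probAwayA N) T (fun v => v) = T.exact ∧
    treeExpQ e2m1 (probAwayB N) T (fun v => v) = T.exact ∧
    treeExpQ e2m1 (probAwayC N) T (fun v => v) = T.exact := by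
  obtain ⟨hA, hB, hC⟩ := e2m1_twoBits_tree_exact hN T hT (fun v => v)
  exact ⟨hA.trans (treeExp_id_of_noSatT e2m1 T hs), hB.trans (treeExp_id_of_noSatT e2m1 T hs),
    hC.trans (treeExp_id_of_noSatT e2m1 T hs)⟩

/-- **Counting, FP4**: every increment `s + 1` of an E2M1 value has a ONE-bit dyadic up-probability
(`0` or `1/2`: the cells above `2` have width `1` or `2`). -/
theorem e2m1_succ_dyadic_one : ∀ s ∈ e2m1, Dyadic 1 (pUp e2m1 (s + 1)) := by
  decide +kernel

/-- Hence ONE random bit reproduces exact-SR COUNTING in FP4 from every format start, for every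
horizon and test function, under A, B and C with any `N ≥ 1` — in contrast with E3M2, where one
bit stagnates at `16` (`e3m2_ones_oneBit_stochasticC_absorbed`). -/
theorem e2m1_oneBit_counter_exact {N : ℕ} (hN : 1 ≤ N) {s : ℚ} (hs : s ∈ e2m1) (n : ℕ)
    (f : ℚ → ℚ) :
    accExpQ e2m1 (probAwayA N) (fun _ => 1) n f s = accExp e2m1 (fun _ => 1) n f s ∧
    accExpQ e2m1 (probAwayB N) (fun _ => 1) n f s = accExp e2m1 (fun _ => 1) n f s ∧
    accExpQ e2m1 (probAwayC N) (fun _ => 1) n f s = accExp e2m1 (fun _ => 1) n f s := by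
  have hg : ∀ k : ℕ, ∀ x ∈ e2m1, Dyadic 1 (pUp e2m1 ((fun (_ : ℕ) (t : ℚ) => t + 1) k x)) :=
    fun _ x hx => e2m1_succ_dyadic_one x hx
  obtain ⟨hA, hB, hC⟩ := probAwayABC_of_dyadic_le (K := ℚ) hN
  refine ⟨?_, ?_, ?_⟩ <;>
    rw [accExpQ_eq_recExpQ, accExp_eq_recExp]
  · exact recExpQ_eq_recExp_of_forall_mem e2m1_nonempty hA hg hs n f
  · exact recExpQ_eq_recExp_of_forall_mem e2m1_nonempty hB hg hs n f
  · exact recExpQ_eq_recExp_of_forall_mem e2m1_nonempty hC hg hs n f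

/-- **Counting, FP6 E3M2**: the threshold is TWO bits (`16 + 1 = 17 ∈ (16, 20)` has up-probability
`1/4`; every increment of an E3M2 value is 2-dyadic — 63 states). -/
theorem e3m2_succ_dyadic_two :
    (∀ s ∈ Formats.e3m2, Dyadic 2 (pUp Formats.e3m2 (s + 1))) ∧
    ¬ Dyadic 1 (pUp Formats.e3m2 ((16 : ℚ) + 1)) := by
  constructor
  · decide +kernel
  · decide +kernel

/-- Hence two random bits reproduce exact-SR counting in E3M2 from every format start (the one-bit
stagnation at `16` of file XXVII disappears at exactly `N = 2`, for all horizons, in law). -/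
theorem e3m2_twoBits_counter_exact {N : ℕ} (hN : 2 ≤ N) {s : ℚ} (hs : s ∈ Formats.e3m2) (n : ℕ)
    (f : ℚ → ℚ) :
    accExpQ Formats.e3m2 (probAwayA N) (fun _ => 1) n f s = accExp Formats.e3m2 (fun _ => 1) n f s ∧
    accExpQ Formats.e3m2 (probAwayB N) (fun _ => 1) n f s = accExp Formats.e3m2 (fun _ => 1) n f s ∧
    accExpQ Formats.e3m2 (probAwayC N) (fun _ => 1) n f s
      = accExp Formats.e3m2 (fun _ => 1) n f s := by
  have hg : ∀ k : ℕ, ∀ x ∈ Formats.e3m2,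
      Dyadic 2 (pUp Formats.e3m2 ((fun (_ : ℕ) (t : ℚ) => t + 1) k x)) :=
    fun _ x hx => e3m2_succ_dyadic_two.1 x hx
  obtain ⟨hA, hB, hC⟩ := probAwayABC_of_dyadic_le (K := ℚ) hN
  refine ⟨?_, ?_, ?_⟩ <;>
    rw [accExpQ_eq_recExpQ, accExp_eq_recExp]
  · exact recExpQ_eq_recExp_of_forall_mem Formats.e3m2_nonempty hA hg hs n f
  · exact recExpQ_eq_recExp_of_forall_mem Formats.e3m2_nonempty hB hg hs n f
  · exact recExpQ_eq_recExp_of_forall_mem Formats.e3m2_nonempty hC hg hs n f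

/-! ### The FP4 EMA `x ← ¾x + ¼·(3/2)`: the complete bit ladder -/

/-- **State table, FP4 EMA**: from every E2M1 value the EMA step `¾x + 3/8` has a 4-bit dyadic
up-probability (`15` states; the extreme starts `±6` need all four bits: `39/8 ∈ (4, 6)` has
up-probability `7/16`). -/
theorem e2m1_ema34_dyadic_four :
    (∀ x ∈ e2m1, Dyadic 4 (pUp e2m1 ((3/4 : ℚ) * x + (1 - 3/4) * (3/2)))) ∧
    ¬ Dyadic 3 (pUp e2m1 ((3/4 : ℚ) * 6 + (1 - 3/4) * (3/2))) := by
  constructor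
  · decide +kernel
  · decide +kernel

/-- **Four random bits make the FP4 EMA exactly the exact-SR process**: from every format start,
for every horizon and every test function, under StochasticA, B and C with any `N ≥ 4` bits
(`ema34 = affMap ¾ (¼·3/2)` of file LXXVI). -/
theorem e2m1_ema34_fourBits_exact {N : ℕ} (hN : 4 ≤ N) {s : ℚ} (hs : s ∈ e2m1) (n : ℕ)
    (f : ℚ → ℚ) :
    recExpQ e2m1 (probAwayA N) ema34 n f s = recExp e2m1 ema34 n f s ∧
    recExpQ e2m1 (probAwayB N) ema34 n f s = recExp e2m1 ema34 n f s ∧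
    recExpQ e2m1 (probAwayC N) ema34 n f s = recExp e2m1 ema34 n f s := by
  have hg : ∀ k : ℕ, ∀ x ∈ e2m1, Dyadic 4 (pUp e2m1 (ema34 k x)) :=
    fun _ x hx => e2m1_ema34_dyadic_four.1 x hx
  obtain ⟨hA, hB, hC⟩ := probAwayABC_of_dyadic_le (K := ℚ) hN
  exact ⟨recExpQ_eq_recExp_of_forall_mem e2m1_nonempty hA hg hs n f,
    recExpQ_eq_recExp_of_forall_mem e2m1_nonempty hB hg hs n f,
    recExpQ_eq_recExp_of_forall_mem e2m1_nonempty hC hg hs n f⟩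

/-- **Three bits are NOT enough** (the rung below): from `6` the exact-SR mean after one step is
`39/8` (`= ¾·6 + 3/8`, no saturation), but the 3-bit rules give `19/4` (A), `5` (B), `5` (C). -/
theorem e2m1_ema34_threeBits_inexact :
    recExp e2m1 ema34 1 (fun v => v) 6 = 39 / 8 ∧
    recExpQ e2m1 (probAwayA 3) ema34 1 (fun v => v) 6 = 19 / 4 ∧
    recExpQ e2m1 (probAwayB 3) ema34 1 (fun v => v) 6 = 5 ∧
    recExpQ e2m1 (probAwayC 3) ema34 1 (fun v => v) 6 = 5 := by
  decide +kernel

/-- **Two bits** (file LXXVI: every cell moves): still not the exact law — from `3` the exact mean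
after one step is `21/8`, the 2-bit rules give `5/2` (A), `11/4` (B), `5/2` (C). -/
theorem e2m1_ema34_twoBits_inexact :
    recExp e2m1 ema34 1 (fun v => v) 3 = 21 / 8 ∧
    recExpQ e2m1 (probAwayA 2) ema34 1 (fun v => v) 3 = 5 / 2 ∧
    recExpQ e2m1 (probAwayB 2) ema34 1 (fun v => v) 3 = 11 / 4 ∧
    recExpQ e2m1 (probAwayC 2) ema34 1 (fun v => v) 3 = 5 / 2 := by
  decide +kernel

/-- … while THREE bits are already exact from every start other than `±6` (those 13 states are
3-dyadic), e.g. the whole law from `3` for two steps coincides with exact SR (kernel instance of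
`recExpQ_eq_recExp_of_dyadicR` on a decidable path predicate). -/
theorem e2m1_ema34_threeBits_exact_from_three (f : ℚ → ℚ) :
    recExpQ e2m1 (probAwayC 3) ema34 2 f 3 = recExp e2m1 ema34 2 f 3 :=
  recExpQ_eq_recExp_of_dyadicR e2m1 (fun _ h => probAwayC_of_dyadic h) ema34 2 f 3
    (by decide +kernel)

end Thresholds

end Summit.Ventures.CertifiedArithmetic.LowPrec.SR.LimitedBits
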